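import Summits.CriticalPhenomena.Ising3DConformalLimit.Theorems.PrecisionLaplacianDirectCorrelationStableTailPickInversionAux10

/-!
# Pick inversion, auxiliary file 11: the Brillouin-zone representation of Green quadratic forms

Helper file for stub `stub_pickInversion` of line `self-energy-pick-inversion`, crux
`PrecisionLaplacian.DirectCorrelationStableTail` (stmt-CriticalPhenomena-4799). Pure theorem file.

Let `q ≥ 0` be an even summable step law on `ℤ^d` with `∑ q ≤ 1`, real convolution powers `P`,
symbol `φ(k) = ∑ q(y) cos(k·y)`, and let `G` be the Green function: `∑_j P j z = G z` (file 9).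
With the Abel sums `g_r = ∑ rʲ P j` (file 10):

* `abelGreen_parseval` : `(2π)^d ∑_{z,z'∈S} V z V z' g_r(z - z' + u) = ∫ cos(k·u) W_V(k)/(1 - rφ(k)) dk`
  on `[-π,π]^d`, `W_V(k) = ∑_{z,z'∈S} V z V z' cos(k·(z - z'))` (weighted Parseval);
* `integrableOn_inv_one_sub_symbol` : `(1 - φ)⁻¹` is integrable on `[-π,π]^d` and `φ < 1` a.e. there
  (monotone convergence in `r ↑ 1` at `S = {0}`, using `g_r(0) ≤ G(0)`);
* `green_form_eq_integral` (registered sub-goal `stub_pickInversion_auxGreenForm`): letting `r ↑ 1`,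
  `(2π)^d ∑_{z,z'∈S} V z V z' G(z - z' + u) = ∫_{[-π,π]^d} cos(k·u) W_V(k)/(1 - φ(k)) dk`.
-/

noncomputable section

namespace Summit.CriticalPhenomena.Ising3DConformalLimit.Cruxes.DirectCorrelationStableTail.SelfEnergyPickInversion

open Filter Topology Finset Real MeasureTheory Literature.Probability.LatticeModels
open scoped BigOperators ENNReal
open Summit.CriticalPhenomena.Ising3DConformalLimit.Theorems.EtaBoundsTransfer
  (continuous_phase integrableOn_cube_of_continuous volume_cube_lt_top continuous_fourier_q
    abs_fourier_q_le_one)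

variable {d : ℕ} {q : Site d → ℝ} {P : ℕ → Site d → ℝ}

/-! ### Abel sums: domination by the Green function and convergence -/

/-- `g_r(w) ≤ G(w)` and `g_r(w) → G(w)` as `r ↑ 1`, when `∑_j P j w = G w` with `P ≥ 0`. [folklore] -/
theorem abelGreen_le_tendsto (hPnn : ∀ j z, 0 ≤ P j z) {w : Site d} {Gw : ℝ}
    (hGreen : HasSum (fun j => P j w) Gw) :
    (∀ r : ℝ, 0 ≤ r → r ≤ 1 → ∑' j, r ^ j * P j w ≤ Gw) ∧
      Tendsto (fun r : ℝ => ∑' j, r ^ j * P j w) (𝓝[<] 1) (𝓝 Gw) := by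
  have hs := hGreen.summable
  have hle : ∀ r : ℝ, 0 ≤ r → r ≤ 1 → ∀ j, r ^ j * P j w ≤ P j w := fun r hr0 hr1 j =>
    mul_le_of_le_one_left (hPnn j w) (pow_le_one₀ hr0 hr1)
  constructor
  · intro r hr0 hr1
    rw [← hGreen.tsum_eq]
    exact Summable.tsum_le_tsum (hle r hr0 hr1)
      (Summable.of_nonneg_of_le (fun j => mul_nonneg (pow_nonneg hr0 _) (hPnn j w)) (hle r hr0 hr1) hs) hs
  · rw [← hGreen.tsum_eq]
    refine tendsto_tsum_of_dominated_convergence (bound := fun j => P j w) hs (fun j => ?_) ?_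
    · have : Tendsto (fun r : ℝ => r ^ j * P j w) (𝓝 1) (𝓝 (1 ^ j * P j w)) :=
        ((continuous_pow j).tendsto 1).mul_const _
      rw [one_pow, one_mul] at this
      exact this.mono_left nhdsWithin_le_nhds
    · filter_upwards [Ioo_mem_nhdsLT zero_lt_one] with r hr
      intro j
      rw [Real.norm_eq_abs, abs_of_nonneg (mul_nonneg (pow_nonneg hr.1.le _) (hPnn j w))]
      exact hle r hr.1.le hr.2.le j

/-! ### Weighted Parseval for the Abel sums -/

/-- **Parseval for the Abel-summed Green series**: for `0 ≤ r < 1`, a finite `S`, weights `V` and a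
shift `u`, `(2π)^d ∑_{z,z'∈S} V z V z' g_r(z - z' + u) = ∫_{[-π,π]^d} cos(k·u) (1 - rφ(k))⁻¹ W_V(k) dk`.
[folklore] -/
theorem abelGreen_parseval (hq0 : ∀ y, 0 ≤ q y) (hqs : Summable q) (hq1 : ∑' y, q y ≤ 1)
    (hqev : ∀ y, q (-y) = q y) (hP0 : ∀ z, P 0 z = if z = 0 then 1 else 0)
    (hPs : ∀ j z, P (j + 1) z = ∑' y, q y * P j (z - y)) {r : ℝ} (hr0 : 0 ≤ r) (hr1 : r < 1)
    (S : Finset (Site d)) (V : Site d → ℝ) (u : Site d) :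
    (2 * π) ^ d * ∑ z ∈ S, ∑ z' ∈ S, V z * V z' * ∑' j, r ^ j * P j (z - z' + u) =
      ∫ k in Set.pi Set.univ (fun _ : Fin d => Set.Icc (-π) π),
        (Real.cos (phase d k u) * (1 - r * ∑' y, q y * Real.cos (phase d k y))⁻¹) *
          (∑ z ∈ S, ∑ z' ∈ S, V z * V z' * Real.cos (phase d k (z - z'))) := by
  obtain ⟨-, -, hgev, hgsum, hgfour⟩ := abelGreen_summable_fourier hq0 hqs hq1 hqev hP0 hPs hr0 hr1
  set g : Site d → ℝ := fun w => ∑' j, r ^ j * P j w with hg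
  have hfsum : Summable fun w => g (w + u) := (Equiv.addRight u).summable_iff.2 hgsum
  have hpar := parseval_weighted hfsum S V
  simp only [hg] at hpar ⊢
  rw [← hpar]
  refine integral_congr_ae (Eventually.of_forall fun k => ?_)
  simp only
  rw [tsum_shift_mul_cos hgsum hgev k u, hgfour k]
  ring

/-! ### Integrability of `(1 - φ)⁻¹` on the Brillouin zone -/

/-- **`(1 - φ)⁻¹` is integrable on `[-π,π]^d` and `φ < 1` a.e. there**, when the Green series of the
step law is bounded at the origin: `∑_j P j 0 = G₀ < ∞`. (Monotone convergence as `r ↑ 1` in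
`∫ (1 - rφ)⁻¹ dk = (2π)^d g_r(0) ≤ (2π)^d G₀` on `{φ ≥ 0}`; on `{φ < 0}` the function is `≤ 1`.)
[folklore] -/
theorem integrableOn_inv_one_sub_symbol (hq0 : ∀ y, 0 ≤ q y) (hqs : Summable q) (hq1 : ∑' y, q y ≤ 1)
    (hqev : ∀ y, q (-y) = q y) (hP0 : ∀ z, P 0 z = if z = 0 then 1 else 0)
    (hPs : ∀ j z, P (j + 1) z = ∑' y, q y * P j (z - y))
    {G₀ : ℝ} (hG₀ : HasSum (fun j => P j 0) G₀) :
    IntegrableOn (fun k : Fin d → ℝ => (1 - ∑' y, q y * Real.cos (phase d k y))⁻¹)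
        (Set.pi Set.univ (fun _ : Fin d => Set.Icc (-π) π)) ∧
      ∀ᵐ k ∂(volume.restrict (Set.pi Set.univ (fun _ : Fin d => Set.Icc (-π) π))),
        ∑' y, q y * Real.cos (phase d k y) < 1 := by
  set K := Set.pi Set.univ (fun _ : Fin d => Set.Icc (-π) π) with hK
  set μ : Measure (Fin d → ℝ) := volume.restrict K with hμ
  haveI : IsFiniteMeasure μ := ⟨by rw [hμ, Measure.restrict_apply_univ]; exact volume_cube_lt_top⟩
  set φ : (Fin d → ℝ) → ℝ := fun k => ∑' y, q y * Real.cos (phase d k y) with hφ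
  have hφcont : Continuous φ := continuous_fourier_q hqs
  have hφle : ∀ k, φ k ≤ 1 := fun k => (abs_le.1 (abs_fourier_q_le_one hq0 hqs hq1 k)).2
  have hφge : ∀ k, -1 ≤ φ k := fun k => (abs_le.1 (abs_fourier_q_le_one hq0 hqs hq1 k)).1
  have hPnn : ∀ j z, 0 ≤ P j z := fun j => (convPow_nonneg_summable hq0 hqs hq1 hP0 hPs j).1
  -- the sequence `r_m = 1 - 1/(m+2)`
  set rs : ℕ → ℝ := fun m => 1 - 1 / ((m : ℝ) + 2) with hrs
  have hrs_lt : ∀ m, rs m < 1 := fun m => by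
    simp only [hrs]; have : (0 : ℝ) < 1 / ((m : ℝ) + 2) := by positivity
    linarith
  have hrs_ge : ∀ m, 0 ≤ rs m := fun m => by
    simp only [hrs]
    have : 1 / ((m : ℝ) + 2) ≤ 1 / 2 := by
      rw [div_le_div_iff₀ (by positivity) (by positivity)]; linarith [(Nat.cast_nonneg m : (0:ℝ) ≤ m)]
    linarith
  have hrs_mono : Monotone rs := fun m m' hmm' => by
    simp only [hrs]
    have h1 : (0 : ℝ) < (m : ℝ) + 2 := by positivity
    have : 1 / ((m' : ℝ) + 2) ≤ 1 / ((m : ℝ) + 2) :=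
      div_le_div_of_nonneg_left zero_le_one h1 (by exact_mod_cast Nat.add_le_add_right hmm' 2)
    linarith
  have hrs_lim : Tendsto rs atTop (𝓝 1) := by
    have h : Tendsto (fun m : ℕ => 1 / ((m : ℝ) + 2)) atTop (𝓝 0) :=
      tendsto_const_nhds.div_atTop (tendsto_atTop_add_const_right _ _ tendsto_natCast_atTop_atTop)
    have h2 : Tendsto (fun m : ℕ => (1 : ℝ) - 1 / ((m : ℝ) + 2)) atTop (𝓝 (1 - 0)) :=
      tendsto_const_nhds.sub h
    simpa [hrs] using h2
  -- positivity and continuity of `(1 - r φ)⁻¹` for `0 ≤ r < 1`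
  have hden_pos : ∀ r : ℝ, 0 ≤ r → r < 1 → ∀ k, 0 < 1 - r * φ k := by
    intro r hr0 hr1 k
    have : r * φ k ≤ r * 1 := mul_le_mul_of_nonneg_left (hφle k) hr0
    linarith
  have hcont_r : ∀ r : ℝ, 0 ≤ r → r < 1 → Continuous fun k => (1 - r * φ k)⁻¹ := fun r hr0 hr1 =>
    Continuous.inv₀ (by fun_prop) fun k => (hden_pos r hr0 hr1 k).ne'
  -- `∫ (1 - r_m φ)⁻¹ dμ ≤ (2π)^d G₀`
  have hbound : ∀ m, ∫ k, (1 - rs m * φ k)⁻¹ ∂μ ≤ (2 * π) ^ d * G₀ := by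
    intro m
    have hpar := abelGreen_parseval hq0 hqs hq1 hqev hP0 hPs (hrs_ge m) (hrs_lt m) {0} (fun _ => 1) 0
    have hphase0 : ∀ k : Fin d → ℝ, phase d k 0 = 0 := fun k => by simp [phase]
    simp only [Finset.sum_singleton, sub_self, zero_add, one_mul, hphase0, Real.cos_zero, mul_one] at hpar
    rw [hμ, ← hpar]
    exact mul_le_mul_of_nonneg_left ((abelGreen_le_tendsto hPnn hG₀).1 (rs m) (hrs_ge m) (hrs_lt m).le)
      (by positivity)
  -- monotone convergence on `{φ ≥ 0}`
  set A : Set (Fin d → ℝ) := {k | 0 ≤ φ k} with hA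
  have hAm : MeasurableSet A := (isClosed_le continuous_const hφcont).measurableSet
  set f : ℕ → (Fin d → ℝ) → ℝ≥0∞ := fun m k => ENNReal.ofReal ((1 - rs m * φ k)⁻¹) with hf
  have hf_meas : ∀ m, AEMeasurable (f m) (μ.restrict A) := fun m =>
    (ENNReal.measurable_ofReal.comp (hcont_r _ (hrs_ge m) (hrs_lt m)).measurable).aemeasurable
  have hf_mono : ∀ᵐ k ∂(μ.restrict A), Monotone fun m => f m k := by
    filter_upwards [ae_restrict_mem hAm] with k hk
    intro m m' hmm'
    refine ENNReal.ofReal_le_ofReal (inv_anti₀ (hden_pos _ (hrs_ge m') (hrs_lt m') k) ?_)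
    have := mul_le_mul_of_nonneg_right (hrs_mono hmm') (show 0 ≤ φ k from hk)
    linarith
  have hlint : ∀ m, ∫⁻ k, f m k ∂(μ.restrict A) ≤ ENNReal.ofReal ((2 * π) ^ d * G₀) := by
    intro m
    have hint : Integrable (fun k => (1 - rs m * φ k)⁻¹) μ :=
      integrableOn_cube_of_continuous (hcont_r _ (hrs_ge m) (hrs_lt m))
    have hnn : 0 ≤ᵐ[μ] fun k => (1 - rs m * φ k)⁻¹ :=
      Eventually.of_forall fun k => (inv_pos.2 (hden_pos _ (hrs_ge m) (hrs_lt m) k)).le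
    calc ∫⁻ k, f m k ∂(μ.restrict A) ≤ ∫⁻ k, f m k ∂μ := lintegral_mono' Measure.restrict_le_self le_rfl
      _ = ENNReal.ofReal (∫ k, (1 - rs m * φ k)⁻¹ ∂μ) := by
          rw [hf]; exact (ofReal_integral_eq_lintegral_ofReal hint hnn).symm
      _ ≤ ENNReal.ofReal ((2 * π) ^ d * G₀) := ENNReal.ofReal_le_ofReal (hbound m)
  have hsup : ∫⁻ k, ⨆ m, f m k ∂(μ.restrict A) ≤ ENNReal.ofReal ((2 * π) ^ d * G₀) := by
    rw [lintegral_iSup' hf_meas hf_mono]; exact iSup_le hlint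
  have hW_lt : ∀ᵐ k ∂(μ.restrict A), (⨆ m, f m k) < ⊤ :=
    ae_lt_top' (AEMeasurable.iSup hf_meas) (ne_top_of_le_ne_top ENNReal.ofReal_ne_top hsup)
  -- where `φ = 1` the supremum is infinite; where `0 ≤ φ < 1` it dominates `(1 - φ)⁻¹`
  have hW_top : ∀ k, φ k = 1 → (⨆ m, f m k) = ⊤ := by
    intro k hk
    apply ENNReal.eq_top_of_forall_nnreal_le fun c => ?_
    obtain ⟨m, hm⟩ := exists_nat_ge (c : ℝ)
    refine le_trans ?_ (le_iSup (fun m => f m k) m)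
    have hval : (1 - rs m * φ k)⁻¹ = (m : ℝ) + 2 := by
      rw [hk, mul_one]; simp only [hrs]; field_simp; ring
    simp only [hf, hval]
    rw [← ENNReal.ofReal_coe_nnreal]
    exact ENNReal.ofReal_le_ofReal (by linarith)
  have hW_ge : ∀ k, φ k < 1 → ENNReal.ofReal ((1 - φ k)⁻¹) ≤ ⨆ m, f m k := by
    intro k hk
    have hcont : ContinuousAt (fun r : ℝ => (1 - r * φ k)⁻¹) 1 :=
      ContinuousAt.inv₀ (by fun_prop) (by simp; linarith)
    have hlim : Tendsto (fun m => f m k) atTop (𝓝 (ENNReal.ofReal ((1 - φ k)⁻¹))) := by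
      have h1 := hcont.tendsto.comp hrs_lim
      have h2 := (ENNReal.continuous_ofReal.tendsto _).comp h1
      simpa [hf, Function.comp_def] using h2
    exact le_of_tendsto' hlim fun m => le_iSup (fun m => f m k) m
  -- consequences: `φ < 1` a.e. on the cube
  have hnull : μ {k | φ k = 1} = 0 := by
    have h1 : (μ.restrict A) {k | ¬ (⨆ m, f m k) < ⊤} = 0 := ae_iff.1 hW_lt
    have h2 : μ ({k | φ k = 1} ∩ A) = 0 := by
      rw [← Measure.restrict_apply' hAm]
      refine measure_mono_null (fun k hk => ?_) h1
      simp only [Set.mem_setOf_eq, not_lt, top_le_iff]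
      exact hW_top k hk
    have h3 : {k | φ k = 1} ∩ A = {k | φ k = 1} := by
      ext k; simp only [Set.mem_inter_iff, Set.mem_setOf_eq, hA, and_iff_left_iff_imp]
      intro hk; rw [hk]; exact zero_le_one
    rwa [h3] at h2
  have hae_lt : ∀ᵐ k ∂μ, φ k < 1 := by
    rw [ae_iff]
    refine measure_mono_null (fun k hk => ?_) hnull
    simp only [Set.mem_setOf_eq, not_lt] at hk ⊢
    exact le_antisymm (hφle k) hk
  refine ⟨⟨(Continuous.measurable (by fun_prop : Continuous fun k => 1 - φ k)).inv.aestronglyMeasurable, ?_⟩,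
    hae_lt⟩
  -- finite integral: split the cube into `{φ ≥ 0}` and `{φ < 0}`
  have hsplit := lintegral_add_compl (μ := μ) (fun k => ‖(1 - φ k)⁻¹‖ₑ) hAm
  rw [HasFiniteIntegral, ← hsplit]
  refine ENNReal.add_lt_top.2 ⟨?_, ?_⟩
  · refine lt_of_le_of_lt (le_trans (lintegral_mono_ae ?_) hsup) ENNReal.ofReal_lt_top
    filter_upwards [ae_restrict_of_ae hae_lt] with k hk
    rw [Real.enorm_eq_ofReal (inv_nonneg.2 (by linarith))]
    exact hW_ge k hk
  · have hle1 : ∀ k ∈ Aᶜ, ‖(1 - φ k)⁻¹‖ₑ ≤ 1 := by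
      intro k hk
      simp only [hA, Set.mem_compl_iff, Set.mem_setOf_eq, not_le] at hk
      have h1 : 0 ≤ (1 - φ k)⁻¹ := inv_nonneg.2 (by linarith)
      rw [Real.enorm_eq_ofReal h1, ← ENNReal.ofReal_one]
      exact ENNReal.ofReal_le_ofReal (inv_le_one_of_one_le₀ (by linarith))
    calc ∫⁻ k in Aᶜ, ‖(1 - φ k)⁻¹‖ₑ ∂μ ≤ ∫⁻ k in Aᶜ, 1 ∂μ := setLIntegral_mono measurable_const hle1
      _ = μ Aᶜ := by rw [setLIntegral_const, one_mul]
      _ < ⊤ := measure_lt_top _ _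

/-! ### The Green quadratic forms as Brillouin-zone integrals -/

/-- **Green quadratic forms on the Brillouin zone.** With the notation above, if `∑_j P j z = G z`
for every `z` (the Green function of `q`), then for every finite `S`, weights `V` and shift `u`,
`(2π)^d ∑_{z,z'∈S} V z V z' G(z - z' + u) = ∫_{[-π,π]^d} cos(k·u) (1 - φ(k))⁻¹ W_V(k) dk`.
[folklore] -/
theorem green_form_eq_integral (hq0 : ∀ y, 0 ≤ q y) (hqs : Summable q) (hq1 : ∑' y, q y ≤ 1)
    (hqev : ∀ y, q (-y) = q y) (hP0 : ∀ z, P 0 z = if z = 0 then 1 else 0)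
    (hPs : ∀ j z, P (j + 1) z = ∑' y, q y * P j (z - y))
    {G : Site d → ℝ} (hGreen : ∀ z, HasSum (fun j => P j z) (G z))
    (S : Finset (Site d)) (V : Site d → ℝ) (u : Site d) :
    (2 * π) ^ d * ∑ z ∈ S, ∑ z' ∈ S, V z * V z' * G (z - z' + u) =
      ∫ k in Set.pi Set.univ (fun _ : Fin d => Set.Icc (-π) π),
        (Real.cos (phase d k u) * (1 - ∑' y, q y * Real.cos (phase d k y))⁻¹) *
          (∑ z ∈ S, ∑ z' ∈ S, V z * V z' * Real.cos (phase d k (z - z'))) := by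
  set K := Set.pi Set.univ (fun _ : Fin d => Set.Icc (-π) π) with hK
  set μ : Measure (Fin d → ℝ) := volume.restrict K with hμ
  haveI : IsFiniteMeasure μ := ⟨by rw [hμ, Measure.restrict_apply_univ]; exact volume_cube_lt_top⟩
  set φ : (Fin d → ℝ) → ℝ := fun k => ∑' y, q y * Real.cos (phase d k y) with hφ
  set W : (Fin d → ℝ) → ℝ := fun k => ∑ z ∈ S, ∑ z' ∈ S, V z * V z' * Real.cos (phase d k (z - z')) with hW
  have hφcont : Continuous φ := continuous_fourier_q hqs
  have hφle : ∀ k, φ k ≤ 1 := fun k => (abs_le.1 (abs_fourier_q_le_one hq0 hqs hq1 k)).2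
  have hPnn : ∀ j z, 0 ≤ P j z := fun j => (convPow_nonneg_summable hq0 hqs hq1 hP0 hPs j).1
  obtain ⟨hint, hae_lt⟩ := integrableOn_inv_one_sub_symbol hq0 hqs hq1 hqev hP0 hPs (hGreen 0)
  set B : ℝ := ∑ z ∈ S, ∑ z' ∈ S, |V z| * |V z'| with hB
  have hWcont : Continuous W := by
    simp only [hW]
    refine continuous_finsetSum _ fun y _ => continuous_finsetSum _ fun y' _ => ?_
    have := continuous_phase (d := d) (y - y'); fun_prop
  have hWbd : ∀ k, |W k| ≤ B := by
    intro k
    simp only [hW, hB]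
    calc |∑ y ∈ S, ∑ y' ∈ S, V y * V y' * Real.cos (phase d k (y - y'))|
        ≤ ∑ y ∈ S, |∑ y' ∈ S, V y * V y' * Real.cos (phase d k (y - y'))| := Finset.abs_sum_le_sum_abs _ _
      _ ≤ ∑ y ∈ S, ∑ y' ∈ S, |V y * V y' * Real.cos (phase d k (y - y'))| :=
          Finset.sum_le_sum fun y _ => Finset.abs_sum_le_sum_abs _ _
      _ ≤ ∑ y ∈ S, ∑ y' ∈ S, |V y| * |V y'| :=
          Finset.sum_le_sum fun y _ => Finset.sum_le_sum fun y' _ => by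
            rw [abs_mul, abs_mul]
            exact mul_le_of_le_one_right (by positivity) (Real.abs_cos_le_one _)
  have hB0 : 0 ≤ B := Finset.sum_nonneg fun y _ => Finset.sum_nonneg fun y' _ => by positivity
  -- left-hand side: `r ↑ 1`
  have hL : Tendsto (fun r : ℝ => (2 * π) ^ d * ∑ z ∈ S, ∑ z' ∈ S, V z * V z' * ∑' j, r ^ j * P j (z - z' + u))
      (𝓝[<] 1) (𝓝 ((2 * π) ^ d * ∑ z ∈ S, ∑ z' ∈ S, V z * V z' * G (z - z' + u))) := by
    refine Tendsto.const_mul _ (tendsto_finsetSum _ fun z _ => tendsto_finsetSum _ fun z' _ => ?_)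
    exact ((abelGreen_le_tendsto hPnn (hGreen (z - z' + u))).2).const_mul _
  -- right-hand side: dominated convergence
  have hR : Tendsto (fun r : ℝ => ∫ k, (Real.cos (phase d k u) * (1 - r * φ k)⁻¹) * W k ∂μ)
      (𝓝[<] 1) (𝓝 (∫ k, (Real.cos (phase d k u) * (1 - φ k)⁻¹) * W k ∂μ)) := by
    have hev : ∀ᶠ r in 𝓝[<] (1 : ℝ), r ∈ Set.Ioo (0 : ℝ) 1 := Ioo_mem_nhdsLT zero_lt_one
    refine tendsto_integral_filter_of_dominated_convergence (fun k => B * ((1 - φ k)⁻¹ + 1)) ?_ ?_ ?_ ?_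
    · filter_upwards [hev] with r hr
      refine (Continuous.aestronglyMeasurable ?_)
      have hc := continuous_phase (d := d) u
      have : Continuous fun k => (1 - r * φ k)⁻¹ := Continuous.inv₀ (by fun_prop) fun k => by
        have : r * φ k ≤ r * 1 := mul_le_mul_of_nonneg_left (hφle k) hr.1.le
        linarith [hr.2]
      fun_prop
    · filter_upwards [hev] with r hr
      filter_upwards [hae_lt] with k hk
      have h1 : |(1 - r * φ k)⁻¹| ≤ (1 - φ k)⁻¹ + 1 := by
        have hpos : 0 < 1 - r * φ k := by
          have : r * φ k ≤ r * 1 := mul_le_mul_of_nonneg_left (hφle k) hr.1.le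
          linarith [hr.2]
        rw [abs_of_pos (inv_pos.2 hpos)]
        have hinv0 : 0 ≤ (1 - φ k)⁻¹ := inv_nonneg.2 (by linarith)
        by_cases hφ0 : 0 ≤ φ k
        · have : (1 - r * φ k)⁻¹ ≤ (1 - φ k)⁻¹ := by
            apply inv_anti₀ (by linarith)
            have := mul_le_mul_of_nonneg_right hr.2.le hφ0
            linarith
          linarith
        · push Not at hφ0
          have : (1 - r * φ k)⁻¹ ≤ 1 := inv_le_one_of_one_le₀ (by nlinarith [hr.1])
          linarith
      rw [Real.norm_eq_abs, abs_mul, abs_mul]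
      calc |Real.cos (phase d k u)| * |(1 - r * φ k)⁻¹| * |W k| ≤ 1 * ((1 - φ k)⁻¹ + 1) * B :=
            mul_le_mul (mul_le_mul (Real.abs_cos_le_one _) h1 (abs_nonneg _) zero_le_one) (hWbd k)
              (abs_nonneg _) (by positivity)
        _ = B * ((1 - φ k)⁻¹ + 1) := by ring
    · exact (hint.add (integrable_const 1)).const_mul B
    · filter_upwards [hae_lt] with k hk
      have hcont : ContinuousAt (fun r : ℝ => (Real.cos (phase d k u) * (1 - r * φ k)⁻¹) * W k) 1 := by
        refine ContinuousAt.mul (ContinuousAt.mul continuousAt_const (ContinuousAt.inv₀ (by fun_prop) ?_))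
          continuousAt_const
        simp; linarith
      have h := hcont.tendsto
      simp only [one_mul] at h
      exact h.mono_left nhdsWithin_le_nhds
  -- the identity for `0 < r < 1` and the conclusion
  have heq : (fun r : ℝ => (2 * π) ^ d * ∑ z ∈ S, ∑ z' ∈ S, V z * V z' * ∑' j, r ^ j * P j (z - z' + u))
      =ᶠ[𝓝[<] 1] fun r : ℝ => ∫ k, (Real.cos (phase d k u) * (1 - r * φ k)⁻¹) * W k ∂μ := by
    filter_upwards [Ioo_mem_nhdsLT zero_lt_one] with r hr
    exact abelGreen_parseval hq0 hqs hq1 hqev hP0 hPs hr.1.le hr.2 S V u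
  exact tendsto_nhds_unique (hL.congr' heq) hR

/-- **Registered auxiliary stub `stub_pickInversion_auxGreenForm`** (sub-goal of `stub_pickInversion`):
Green quadratic forms on `ℤ³` as Brillouin-zone integrals (`green_form_eq_integral`). [folklore] -/
theorem stub_pickInversion_auxGreenForm : ∀ (q : Site 3 → ℝ) (P : ℕ → Site 3 → ℝ) (G : Site 3 → ℝ),
    (∀ y, 0 ≤ q y) → Summable q → ∑' y, q y ≤ 1 → (∀ y, q (-y) = q y) →
    (∀ z, P 0 z = if z = 0 then 1 else 0) → (∀ j z, P (j + 1) z = ∑' y, q y * P j (z - y)) →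
    (∀ z, HasSum (fun j => P j z) (G z)) →
    ∀ (S : Finset (Site 3)) (V : Site 3 → ℝ) (u : Site 3),
      (2 * Real.pi) ^ 3 * ∑ z ∈ S, ∑ z' ∈ S, V z * V z' * G (z - z' + u) =
        ∫ k in Set.pi Set.univ (fun _ : Fin 3 => Set.Icc (-Real.pi) Real.pi),
          (Real.cos (∑ i, k i * (u i : ℝ)) * (1 - ∑' y, q y * Real.cos (∑ i, k i * (y i : ℝ)))⁻¹) *
            (∑ z ∈ S, ∑ z' ∈ S, V z * V z' * Real.cos (∑ i, k i * ((z - z') i : ℝ))) :=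
  fun _ _ _ hq0 hqs hq1 hqev hP0 hPs hGreen S V u => by
    have h := green_form_eq_integral hq0 hqs hq1 hqev hP0 hPs hGreen S V u
    simpa only [phase] using h

end Summit.CriticalPhenomena.Ising3DConformalLimit.Cruxes.DirectCorrelationStableTail.SelfEnergyPickInversion

end
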